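import Mathlib.Data.Real.Basic
import Mathlib.Tactic.Linarith
import Mathlib.Tactic.Ring
import Mathlib.Tactic.Positivity
import HarnessLib

/-!
# The quartic isolation law `(Q4)` implies the `λ = 1` face `(C₁)` pointwise

Support file for crux `stmt-CriticalPhenomena-4575` (`NoHeavyLowerTail`), seat `prim-l12-p1` gen 24 (`--supports stmt-CriticalPhenomena-4575`);
companion of `…ThreePointIsoSexticFace` (`face_half_of_isoSexticPort`: the PORT component of the sextic law `(Q6)` implies the face inequality
`(C½)`, `2q(1−q−s−t−u) ≤ (t+u)(1+2s)`).  Memo `run/shared/lean/prim/prim-l12/FROM-prim-l12-p1-g24-TCB-SUPERTERMINAL.md` §1–§2.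
No definitions, no sorries, standard axioms; pure real arithmetic.

For a 5-cell law `(q, s, t, u, x)` of a triple `(a,b;c)` — `q = P(a|b|c)`, `s = P(ab|c)`, `t = P(ac|b)`, `u = P(bc|a)`, `x = P(abc) = 1−q−s−t−u` — the port
component of `(Q4)` reads `q⁴ ≤ (q+u)²(q+t)²(q+s)` (`Q⁴ ≤ I_a²I_b²I_c`), and the `λ = 1` member `(C₁)` of the face family `(C_λ)`
(`xq ≤ (λ+s)(t+u)`; INEQ-CLAIMS row (C_λ)) is `q·x ≤ (t+u)(1+s)`, i.e. `P(abc)·P(a|b|c) ≤ [P(ac|b)+P(bc|a)]·[1+P(ab|c)]` — the row (R½) of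
prim-nh-lead-4575 gen 125 — i.e. `r := P(c joins exactly one of a,b)/[P(c∼{a,b})·P(a≁b)] ≥ ½`.

* `face_one_identity` — with `m = q + (t+u)/2` and `T = t+u`:
  `m⁴·[T(1+s) − q(1−q−s−T)] = (q+T)·(m⁴(q+s) − q⁴) + T²·(q³/2 + q²T + (7/16)qT² + T³/16)`;
* `face_one_of_isoQuartic` — **for `q,s,t,u ≥ 0` with `q⁴ ≤ (q+u)²(q+t)²(q+s)`: `q(1−q−s−t−u) ≤ (t+u)(1+s)`** (AM–GM `(q+u)(q+t) ≤ m²`, the identity,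
  `m > 0` or the trivial case `m = 0`).
The same algebra applied to the super-terminal quartic law `V4` of the memo (`Q'⁴ ≤ I'_A²I'_b²I'_c`, block `{s,a}` internally connected, port `c`)
gives the one-sided row `P3_{1/2}` that `IncStar.tcb_of_oneSided` (file `…IncStarTwoSidedClusterBoundOneSided`) turns into the lead's TCB.
-/

namespace Summit.CriticalPhenomena.PercolationContinuityZ3.Theorems.ThreePointIsoQuarticFace

/-- The polynomial identity behind the quartic face lemma: with `m = q + (t+u)/2`,
`m⁴·[(t+u)(1+s) − q(1−q−s−t−u)] = (q+t+u)(m⁴(q+s) − q⁴) + (t+u)²(q³/2 + q²(t+u) + (7/16)q(t+u)² + (t+u)³/16)`. [this work] -/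
theorem face_one_identity (q s t u : ℝ) :
    (q + (t + u) / 2) ^ 4 * ((t + u) * (1 + s) - q * (1 - q - s - t - u)) =
      (q + (t + u)) * ((q + (t + u) / 2) ^ 4 * (q + s) - q ^ 4) +
        (t + u) ^ 2 * (q ^ 3 / 2 + q ^ 2 * (t + u) + 7 / 16 * q * (t + u) ^ 2 + (t + u) ^ 3 / 16) := by
  ring

/-- **The port component of `(Q4)` implies the face inequality `(C₁)` (pointwise, for every 5-cell law).**
For `q, s, t, u ≥ 0` with `q⁴ ≤ (q+u)²(q+t)²(q+s)` one has `q(1−q−s−t−u) ≤ (t+u)(1+s)`, i.e. `q·x ≤ (t+u)(1+s)` with `x = 1−q−s−t−u`. [this work] -/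
theorem face_one_of_isoQuartic {q s t u : ℝ} (hq : 0 ≤ q) (hs : 0 ≤ s) (ht : 0 ≤ t) (hu : 0 ≤ u)
    (h4 : q ^ 4 ≤ (q + u) ^ 2 * (q + t) ^ 2 * (q + s)) :
    q * (1 - q - s - t - u) ≤ (t + u) * (1 + s) := by
  set m := q + (t + u) / 2 with hm
  have hm0 : 0 ≤ m := by positivity
  have hT0 : 0 ≤ t + u := by positivity
  have hP0 : 0 ≤ (q + u) * (q + t) := by positivity
  have hP : (q + u) * (q + t) ≤ m ^ 2 := by rw [hm]; nlinarith [sq_nonneg (t - u)]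
  have hP2 : ((q + u) * (q + t)) ^ 2 ≤ (m ^ 2) ^ 2 := pow_le_pow_left₀ hP0 hP 2
  have hqs : 0 ≤ q + s := by positivity
  have hH : q ^ 4 ≤ m ^ 4 * (q + s) := by
    calc q ^ 4 ≤ (q + u) ^ 2 * (q + t) ^ 2 * (q + s) := h4
      _ = ((q + u) * (q + t)) ^ 2 * (q + s) := by ring
      _ ≤ (m ^ 2) ^ 2 * (q + s) := mul_le_mul_of_nonneg_right hP2 hqs
      _ = m ^ 4 * (q + s) := by ring
  have hR : 0 ≤ (q + (t + u)) * (m ^ 4 * (q + s) - q ^ 4) +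
      (t + u) ^ 2 * (q ^ 3 / 2 + q ^ 2 * (t + u) + 7 / 16 * q * (t + u) ^ 2 + (t + u) ^ 3 / 16) := by
    have h1 : 0 ≤ (q + (t + u)) * (m ^ 4 * (q + s) - q ^ 4) := mul_nonneg (by positivity) (by linarith)
    have h2 : 0 ≤ (t + u) ^ 2 * (q ^ 3 / 2 + q ^ 2 * (t + u) + 7 / 16 * q * (t + u) ^ 2 + (t + u) ^ 3 / 16) := by
      positivity
    linarith
  have key := face_one_identity q s t u
  rw [← hm] at key
  -- `m⁴ · X = R ≥ 0`; if `m = 0` then `q = t = u = 0` and the claim is `0 ≤ 0`.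
  rcases eq_or_lt_of_le hm0 with h0 | hpos
  · have hq0 : q = 0 := by rw [hm] at h0; linarith
    have htu : t + u = 0 := by rw [hm] at h0; linarith
    rw [hq0, htu]; simp
  · have h4pos : 0 < m ^ 4 := by positivity
    have hX : 0 ≤ (t + u) * (1 + s) - q * (1 - q - s - t - u) :=
      (mul_nonneg_iff_of_pos_left h4pos).mp (key ▸ hR)
    linarith

/-- The same statement in the `r`-normalisation: `2·[t+u] ≥ (x+t+u)(q+t+u)` with `x = 1−q−s−t−u`, i.e. `r ≥ ½`
(because `(x+t+u)(q+t+u) = xq + (t+u)(1−s)` on the simplex). [this work] -/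
theorem rHalf_of_isoQuartic {q s t u : ℝ} (hq : 0 ≤ q) (hs : 0 ≤ s) (ht : 0 ≤ t) (hu : 0 ≤ u)
    (h4 : q ^ 4 ≤ (q + u) ^ 2 * (q + t) ^ 2 * (q + s)) :
    ((1 - q - s - t - u) + t + u) * (q + t + u) ≤ 2 * (t + u) := by
  have h := face_one_of_isoQuartic hq hs ht hu h4
  nlinarith [h]

end Summit.CriticalPhenomena.PercolationContinuityZ3.Theorems.ThreePointIsoQuarticFace
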